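import Summits.KontsevichZagierPeriods.KontsevichZagierPeriods.Theorems.FurushoPentagonPentagonInKZCornerCubes
import Summits.KontsevichZagierPeriods.KontsevichZagierPeriods.Theorems.FurushoPentagonPentagonInKZCornerBlocks
import Summits.KontsevichZagierPeriods.KontsevichZagierPeriods.Theorems.FurushoPentagonPentagonInKZCornerEngineExistEAux

/-!
# `PentagonInKZ`, line `edge-normal-newton-leibniz`: corner engine — Step A.2, the transverse Newton–Leibniz step

Part of the proof of `cornerEngine_uniformlyNull` (crux `FurushoPentagon.PentagonInKZ`,
stmt-KontsevichZagierPeriods-11348), in the abstract engine signature of the lead file (objects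
`Zq, wZ, fd, gd, dd, Ht, Vt, dHt, dVt, op, opV, Af, Bf, dAf, dBf, F, Xb, Yb, Θb` and ONE
hypothesis bundle `H`; see `…CornerReps.lean`, `…CornerCubes.lean`, `…CornerBlocks.lean` for the
calculus of classes `⟦r⟧ = toPeriodAlgebra (toFormalPeriod [r]) ∈ P_ℚ` of cube representations).

STEP A.2 (`stepA_nl`).  After peeling the outermost horizontal variable (Step A.1), the letter-`a`
contribution `Q` on `[0,1]^{k+l+(e+1)}` has integrand
`ρ(θ') · [fd_a(Ξ₁, Η₁) B^ν(x', y; Ξ₁, Η₁) − fd_a(Ξ₁, 0) B^ν(x', y; Ξ₁, 0)]`, `ν = μ ∘ op a`,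
`Ξ₁(θ') = Ξ(θ) s`, `Η₁(θ') = Η(θ)`, `ρ(θ') = σ(θ) Ξ(θ)` (`θ = init θ'`, `s = θ'_{last}`).  It is the
`s' = 1` minus `s' = 0` value of the primitive
`G = ρ(θ') · fd_a(Ξ₁, Η₁ s') · B^ν(x', y; Ξ₁, Η₁ s')` along a NEW last parameter `s' ∈ [0,1]`,
whose `s'`-derivative is the sum of the integrands of `W₁` (the `dd_a`-term) and `W₂` (the
`dB^ν`-term) on `[0,1]^{k+l+(e+2)}` (level-`(e+2)` data `Ξ₂ = Ξ s`, `Η₂ = Η s'`, `ρ₂ = σ Ξ Η`).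
Hence `⟦Q⟧ = ⟦W₁⟧ + ⟦W₂⟧` by rule (3) of Kontsevich–Zagier along the last cube coordinate
(`CornerCubes.cls_newtonLeibniz_open`, hypotheses over the open base cube) and integrand
additivity (`CornerReps.cls_add`).  Ingredients: the blocks of `Fin.snoc w t`
(`CornerEngineNL.snoc_blocks`), the chain/product rule on the fibres (`H`: `∂_η fd_a = dd_a`,
`∂_η Vt = dVt`, termwise in the finite sum `B^ν`), and the semialgebraicity of `G` (composition
with coordinate projections, `qe_comp_proj`, and the combinators of `H`).

References: M. Kontsevich, D. Zagier, *Periods* (2001), §1.2 rules (1), (3);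
J. Bochnak, M. Coste, M.-F. Roy, *Real Algebraic Geometry* (1998), Prop. 2.2.6.
-/

noncomputable section

open Set MeasureTheory
open Literature.NumberTheory.Transcendental
open Literature.ModelTheory.ExponentialFields (IsSemialgebraic)

namespace Summit.KontsevichZagierPeriods.FurushoPentagon.PentagonInKZ

namespace CornerEngineNL

/-! ### Bookkeeping for the transverse Newton–Leibniz step: a new last parameter -/

/-- **Appending a new last parameter**: for `w ∈ ℝ^{k+l+(e+1)}` with blocks `x' | y | θ'` and
`t ∈ ℝ`, the point `Fin.snoc w t ∈ ℝ^{(k+l+(e+1))+1} = ℝ^{k+l+(e+2)}` has blocks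
`x' | y | Fin.snoc θ' t`. [folklore] -/
theorem snoc_blocks (k l e : ℕ) (w : Fin (k + l + (e + 1)) → ℝ) (t : ℝ) :
    (fun i : Fin k => (Fin.snoc w t : Fin (k + l + (e + 1) + 1) → ℝ)
        (Fin.castAdd (e + 2) (Fin.castAdd l i) : Fin (k + l + (e + 2)))) =
        (fun i : Fin k => w (Fin.castAdd (e + 1) (Fin.castAdd l i))) ∧
      (fun j : Fin l => (Fin.snoc w t : Fin (k + l + (e + 1) + 1) → ℝ)
        (Fin.castAdd (e + 2) (Fin.natAdd k j) : Fin (k + l + (e + 2)))) =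
        (fun j : Fin l => w (Fin.castAdd (e + 1) (Fin.natAdd k j))) ∧
      (fun s : Fin (e + 2) => (Fin.snoc w t : Fin (k + l + (e + 1) + 1) → ℝ)
        (Fin.natAdd (k + l) s : Fin (k + l + (e + 2)))) =
        Fin.snoc (fun s : Fin (e + 1) => w (Fin.natAdd (k + l) s)) t := by
  refine ⟨funext fun i => ?_, funext fun j => ?_, funext fun s => ?_⟩
  · have h : (Fin.castAdd (e + 2) (Fin.castAdd l i) : Fin (k + l + (e + 1) + 1)) =
        Fin.castSucc (Fin.castAdd (e + 1) (Fin.castAdd l i)) := Fin.ext rfl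
    rw [h, Fin.snoc_castSucc]
  · have h : (Fin.castAdd (e + 2) (Fin.natAdd k j) : Fin (k + l + (e + 1) + 1)) =
        Fin.castSucc (Fin.castAdd (e + 1) (Fin.natAdd k j)) := Fin.ext rfl
    rw [h, Fin.snoc_castSucc]
  · refine Fin.lastCases ?_ (fun s' => ?_) s
    · simp only [Fin.natAdd_last, Fin.snoc_last]
    · simp only [Fin.natAdd_castSucc, Fin.snoc_castSucc]

/-- Coordinate functions are `ℚ`-semialgebraic (the coordinate polynomial).
[cite: BochnakCosteRoy1998, §2.2] -/
theorem sa_coord {d : ℕ} {W : Set (Fin d → ℝ)} (hW : IsSemialgebraic ℚ W) (i : Fin d) :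
    IsSemialgebraicFunOn ℚ W fun z => z i :=
  (isSemialgebraicFunOn_aeval hW (MvPolynomial.X i : MvPolynomial (Fin d) ℚ)).congr fun z _ => by simp

end CornerEngineNL

/-! ## The abstract corner engine (signature of the lead file, verbatim) -/

section AbstractEngine

variable {m N : ℕ} {ℓ ℓ' : Fin (m + 2)} {α β : ℚ}
  {Zq : Fin (m + 2) → (DrinfeldKohnoTrunc ℚ (Fin 4) N)} {wZ : ∀ {n : ℕ}, (Fin n → Fin (m + 2)) → (DrinfeldKohnoTrunc ℚ (Fin 4) N)}
  {fd gd dd : Fin (m + 2) → ℝ → ℝ → ℝ}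
  {Ht Vt dHt dVt : ∀ {n : ℕ}, (Fin n → Fin (m + 2)) → (Fin n → ℝ) → ℝ → ℝ → ℝ}
  {op opV : Fin (m + 2) → (DrinfeldKohnoTrunc ℚ (Fin 4) N) →ₗ[ℚ] (DrinfeldKohnoTrunc ℚ (Fin 4) N)}
  {Af Bf dAf dBf F : ((DrinfeldKohnoTrunc ℚ (Fin 4) N) →ₗ[ℚ] ℚ) → ∀ {k l : ℕ}, (Fin k → ℝ) → (Fin l → ℝ) → ℝ → ℝ → ℝ}
  {Xb : ∀ k l e : ℕ, (Fin (k + l + e) → ℝ) → Fin k → ℝ}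
  {Yb : ∀ k l e : ℕ, (Fin (k + l + e) → ℝ) → Fin l → ℝ}
  {Θb : ∀ k l e : ℕ, (Fin (k + l + e) → ℝ) → Fin e → ℝ}

variable (H :
    (∀ {n : ℕ} (U : Fin n → Fin (m + 2)), wZ U = ((List.ofFn U).map Zq).prod) ∧
    (∀ (a : Fin (m + 2)) (X : (DrinfeldKohnoTrunc ℚ (Fin 4) N)), op a X = if a = ℓ then Zq ℓ * X - X * Zq ℓ else Zq a * X) ∧
    (∀ (b : Fin (m + 2)) (X : (DrinfeldKohnoTrunc ℚ (Fin 4) N)), opV b X = if b = ℓ' then Zq ℓ' * X - X * Zq ℓ' else Zq b * X) ∧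
    (∀ (μ : (DrinfeldKohnoTrunc ℚ (Fin 4) N) →ₗ[ℚ] ℚ) {k l : ℕ} (x : Fin k → ℝ) (y : Fin l → ℝ) (ξ η : ℝ), Af μ x y ξ η = ∑ U : Fin k → Fin (m + 2), ∑ V : Fin l → Fin (m + 2), (μ (wZ U * wZ V) : ℝ) * (Ht U x ξ η * Vt V y 0 η)) ∧
    (∀ (μ : (DrinfeldKohnoTrunc ℚ (Fin 4) N) →ₗ[ℚ] ℚ) {k l : ℕ} (x : Fin k → ℝ) (y : Fin l → ℝ) (ξ η : ℝ), Bf μ x y ξ η = ∑ U : Fin k → Fin (m + 2), ∑ V : Fin l → Fin (m + 2), (μ (wZ V * wZ U) : ℝ) * (Vt V y ξ η * Ht U x ξ 0)) ∧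
    (∀ (μ : (DrinfeldKohnoTrunc ℚ (Fin 4) N) →ₗ[ℚ] ℚ) {k l : ℕ} (x : Fin k → ℝ) (y : Fin l → ℝ) (ξ η : ℝ), dAf μ x y ξ η = ∑ U : Fin k → Fin (m + 2), ∑ V : Fin l → Fin (m + 2), (μ (wZ U * wZ V) : ℝ) * (dHt U x ξ η * Vt V y 0 η)) ∧
    (∀ (μ : (DrinfeldKohnoTrunc ℚ (Fin 4) N) →ₗ[ℚ] ℚ) {k l : ℕ} (x : Fin k → ℝ) (y : Fin l → ℝ) (ξ η : ℝ), dBf μ x y ξ η = ∑ U : Fin k → Fin (m + 2), ∑ V : Fin l → Fin (m + 2), (μ (wZ V * wZ U) : ℝ) * (dVt V y ξ η * Ht U x ξ 0)) ∧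
    (∀ (μ : (DrinfeldKohnoTrunc ℚ (Fin 4) N) →ₗ[ℚ] ℚ) {k l : ℕ} (x : Fin k → ℝ) (y : Fin l → ℝ) (ξ η : ℝ), F μ x y ξ η = Af μ x y ξ η - Bf μ x y ξ η) ∧
    (∀ (k l e : ℕ) (z : Fin (k + l + e) → ℝ), Xb k l e z = fun i => z (Fin.castAdd e (Fin.castAdd l i))) ∧
    (∀ (k l e : ℕ) (z : Fin (k + l + e) → ℝ), Yb k l e z = fun j => z (Fin.castAdd e (Fin.natAdd k j))) ∧
    (∀ (k l e : ℕ) (z : Fin (k + l + e) → ℝ), Θb k l e z = fun s => z (Fin.natAdd (k + l) s)) ∧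
    (∀ (U : Fin 0 → Fin (m + 2)) (x : Fin 0 → ℝ) (ξ η : ℝ), Ht U x ξ η = 1) ∧
    (∀ (V : Fin 0 → Fin (m + 2)) (y : Fin 0 → ℝ) (ξ η : ℝ), Vt V y ξ η = 1) ∧
    (∀ (U : Fin 0 → Fin (m + 2)) (x : Fin 0 → ℝ) (ξ η : ℝ), dHt U x ξ η = 0) ∧
    (∀ (V : Fin 0 → Fin (m + 2)) (y : Fin 0 → ℝ) (ξ η : ℝ), dVt V y ξ η = 0) ∧
    (∀ {k : ℕ} (U : Fin (k + 1) → Fin (m + 2)) (x : Fin (k + 1) → ℝ) (η : ℝ), Ht U x 0 η = 0) ∧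
    (∀ {l : ℕ} (V : Fin (l + 1) → Fin (m + 2)) (y : Fin (l + 1) → ℝ) (ξ : ℝ), Vt V y ξ 0 = 0) ∧
    (∀ t y : ℝ, fd ℓ t y = 1 / t) ∧
    (∀ x s : ℝ, gd ℓ' x s = 1 / s) ∧
    (∀ x y : ℝ, dd ℓ x y = 0) ∧
    (∀ x y : ℝ, dd ℓ' x y = 0) ∧
    (∀ (μ : (DrinfeldKohnoTrunc ℚ (Fin 4) N) →ₗ[ℚ] ℚ) {k : ℕ} (x₀ : ℝ) (x' : Fin k → ℝ) (ξ η : ℝ), ∑ U : Fin (k + 1) → Fin (m + 2), (μ (wZ U) : ℝ) * Ht U (Fin.cons x₀ x') ξ η = (∑ a : Fin (m + 2), (if a = ℓ then 1 / x₀ else ξ * fd a (ξ * x₀) η) * ∑ U' : Fin k → Fin (m + 2), (μ (Zq a * wZ U') : ℝ) * Ht U' x' (ξ * x₀) η) - (1 / x₀) * ∑ U' : Fin k → Fin (m + 2), (μ (wZ U' * Zq ℓ) : ℝ) * Ht U' x' (ξ * x₀) η) ∧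
    (∀ (μ : (DrinfeldKohnoTrunc ℚ (Fin 4) N) →ₗ[ℚ] ℚ) {l : ℕ} (y₀ : ℝ) (y' : Fin l → ℝ) (ξ η : ℝ), ∑ V : Fin (l + 1) → Fin (m + 2), (μ (wZ V) : ℝ) * Vt V (Fin.cons y₀ y') ξ η = (∑ b : Fin (m + 2), (if b = ℓ' then 1 / y₀ else η * gd b ξ (η * y₀)) * ∑ V' : Fin l → Fin (m + 2), (μ (Zq b * wZ V') : ℝ) * Vt V' y' ξ (η * y₀)) - (1 / y₀) * ∑ V' : Fin l → Fin (m + 2), (μ (wZ V' * Zq ℓ') : ℝ) * Vt V' y' ξ (η * y₀)) ∧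
    (∀ (μ : (DrinfeldKohnoTrunc ℚ (Fin 4) N) →ₗ[ℚ] ℚ) {l : ℕ} (P Q : (DrinfeldKohnoTrunc ℚ (Fin 4) N)) (y : Fin l → ℝ) (η : ℝ), (∀ i, 0 < y i ∧ y i < 1) → 0 < η → η ≤ (β : ℝ) → ∑ V : Fin l → Fin (m + 2), (μ (P * (Zq ℓ * wZ V - wZ V * Zq ℓ) * Q) : ℝ) * Vt V y 0 η = 0) ∧
    (∀ (μ : (DrinfeldKohnoTrunc ℚ (Fin 4) N) →ₗ[ℚ] ℚ) {k : ℕ} (P Q : (DrinfeldKohnoTrunc ℚ (Fin 4) N)) (x : Fin k → ℝ) (ξ : ℝ), (∀ i, 0 < x i ∧ x i < 1) → 0 < ξ → ξ ≤ (α : ℝ) → ∑ U : Fin k → Fin (m + 2), (μ (P * (Zq ℓ' * wZ U - wZ U * Zq ℓ') * Q) : ℝ) * Ht U x ξ 0 = 0) ∧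
    (∀ (μ : (DrinfeldKohnoTrunc ℚ (Fin 4) N) →ₗ[ℚ] ℚ) (P Q : (DrinfeldKohnoTrunc ℚ (Fin 4) N)), μ (P * (Zq ℓ * Zq ℓ' - Zq ℓ' * Zq ℓ) * Q) = 0) ∧
    (∀ (μ : (DrinfeldKohnoTrunc ℚ (Fin 4) N) →ₗ[ℚ] ℚ) (P Q : (DrinfeldKohnoTrunc ℚ (Fin 4) N)) (x y : ℝ), 0 < x → x < (α : ℝ) → 0 < y → y < (β : ℝ) → ∑ a : Fin (m + 2), ∑ b : Fin (m + 2), (fd a x y * gd b x y) * (μ (P * (Zq a * Zq b - Zq b * Zq a) * Q) : ℝ) = 0) ∧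
    (∀ (μ : (DrinfeldKohnoTrunc ℚ (Fin 4) N) →ₗ[ℚ] ℚ) (P Q : (DrinfeldKohnoTrunc ℚ (Fin 4) N)) (s : ℝ), 0 < s → s < (β : ℝ) → ∑ b : Fin (m + 2), gd b 0 s * (μ (P * (Zq ℓ * Zq b - Zq b * Zq ℓ) * Q) : ℝ) = 0) ∧
    (∀ (μ : (DrinfeldKohnoTrunc ℚ (Fin 4) N) →ₗ[ℚ] ℚ) (P Q : (DrinfeldKohnoTrunc ℚ (Fin 4) N)) (t : ℝ), 0 < t → t < (α : ℝ) → ∑ a : Fin (m + 2), fd a t 0 * (μ (P * (Zq ℓ' * Zq a - Zq a * Zq ℓ') * Q) : ℝ) = 0) ∧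
    (∀ (a : Fin (m + 2)) (ξ η : ℝ), 0 ≤ ξ → ξ ≤ (α : ℝ) → 0 ≤ η → η ≤ (β : ℝ) → HasDerivAt (fun y => fd a ξ y) (dd a ξ η) η) ∧
    (∀ (b : Fin (m + 2)) (ξ η : ℝ), 0 ≤ ξ → ξ ≤ (α : ℝ) → 0 ≤ η → η ≤ (β : ℝ) → HasDerivAt (fun x => gd b x η) (dd b ξ η) ξ) ∧
    (∀ {k : ℕ} (U : Fin k → Fin (m + 2)) (x : Fin k → ℝ) (ξ η : ℝ), (∀ i, 0 ≤ x i ∧ x i ≤ 1) → 0 ≤ ξ → ξ ≤ (α : ℝ) → 0 ≤ η → η ≤ (β : ℝ) → HasDerivAt (fun t => Ht U x t η) (dHt U x ξ η) ξ) ∧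
    (∀ {l : ℕ} (V : Fin l → Fin (m + 2)) (y : Fin l → ℝ) (ξ η : ℝ), (∀ i, 0 ≤ y i ∧ y i ≤ 1) → 0 ≤ ξ → ξ ≤ (α : ℝ) → 0 ≤ η → η ≤ (β : ℝ) → HasDerivAt (fun s => Vt V y ξ s) (dVt V y ξ η) η) ∧
    (∀ {k : ℕ} (U : Fin (k + 1) → Fin (m + 2)) (x₀ : ℝ) (x' : Fin k → ℝ) (ξ η : ℝ), 0 < x₀ → x₀ < 1 → (∀ i, 0 ≤ x' i ∧ x' i ≤ 1) → 0 ≤ ξ → ξ ≤ (α : ℝ) → 0 ≤ η → η ≤ (β : ℝ) → HasDerivAt (fun t => t * Ht U (Fin.cons t x') ξ η) (ξ * dHt U (Fin.cons x₀ x') ξ η) x₀) ∧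
    (∀ {l : ℕ} (V : Fin (l + 1) → Fin (m + 2)) (y₀ : ℝ) (y' : Fin l → ℝ) (ξ η : ℝ), 0 < y₀ → y₀ < 1 → (∀ i, 0 ≤ y' i ∧ y' i ≤ 1) → 0 ≤ ξ → ξ ≤ (α : ℝ) → 0 ≤ η → η ≤ (β : ℝ) → HasDerivAt (fun t => t * Vt V (Fin.cons t y') ξ η) (η * dVt V (Fin.cons y₀ y') ξ η) y₀) ∧
    (∀ {k : ℕ} (U : Fin (k + 1) → Fin (m + 2)) (x' : Fin k → ℝ) (ξ η : ℝ), (∀ i, 0 ≤ x' i ∧ x' i ≤ 1) → 0 ≤ ξ → ξ ≤ (α : ℝ) → 0 ≤ η → η ≤ (β : ℝ) → ContinuousOn (fun t => t * Ht U (Fin.cons t x') ξ η) (Set.Icc 0 1)) ∧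
    (∀ {l : ℕ} (V : Fin (l + 1) → Fin (m + 2)) (y' : Fin l → ℝ) (ξ η : ℝ), (∀ i, 0 ≤ y' i ∧ y' i ≤ 1) → 0 ≤ ξ → ξ ≤ (α : ℝ) → 0 ≤ η → η ≤ (β : ℝ) → ContinuousOn (fun t => t * Vt V (Fin.cons t y') ξ η) (Set.Icc 0 1)) ∧
    (∀ {d : ℕ} {W : Set (Fin d → ℝ)}, IsSemialgebraic ℚ W → ∀ (a : Fin (m + 2)) {T Y : (Fin d → ℝ) → ℝ}, IsSemialgebraicFunOn ℚ W T → IsSemialgebraicFunOn ℚ W Y → IsSemialgebraicFunOn ℚ W fun z => fd a (T z) (Y z)) ∧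
    (∀ {d : ℕ} {W : Set (Fin d → ℝ)}, IsSemialgebraic ℚ W → ∀ (b : Fin (m + 2)) {T Y : (Fin d → ℝ) → ℝ}, IsSemialgebraicFunOn ℚ W T → IsSemialgebraicFunOn ℚ W Y → IsSemialgebraicFunOn ℚ W fun z => gd b (T z) (Y z)) ∧
    (∀ {d : ℕ} {W : Set (Fin d → ℝ)}, IsSemialgebraic ℚ W → ∀ (a : Fin (m + 2)) {T Y : (Fin d → ℝ) → ℝ}, IsSemialgebraicFunOn ℚ W T → IsSemialgebraicFunOn ℚ W Y → IsSemialgebraicFunOn ℚ W fun z => dd a (T z) (Y z)) ∧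
    (∀ {d : ℕ} {W : Set (Fin d → ℝ)}, IsSemialgebraic ℚ W → ∀ {n : ℕ} (U : Fin n → Fin (m + 2)) {X : (Fin d → ℝ) → Fin n → ℝ} {P Q : (Fin d → ℝ) → ℝ}, (∀ i, IsSemialgebraicFunOn ℚ W fun z => X z i) → IsSemialgebraicFunOn ℚ W P → IsSemialgebraicFunOn ℚ W Q → IsSemialgebraicFunOn ℚ W fun z => Ht U (X z) (P z) (Q z)) ∧
    (∀ {d : ℕ} {W : Set (Fin d → ℝ)}, IsSemialgebraic ℚ W → ∀ {n : ℕ} (V : Fin n → Fin (m + 2)) {Y : (Fin d → ℝ) → Fin n → ℝ} {P Q : (Fin d → ℝ) → ℝ}, (∀ i, IsSemialgebraicFunOn ℚ W fun z => Y z i) → IsSemialgebraicFunOn ℚ W P → IsSemialgebraicFunOn ℚ W Q → IsSemialgebraicFunOn ℚ W fun z => Vt V (Y z) (P z) (Q z)) ∧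
    (∀ {d : ℕ} {W : Set (Fin d → ℝ)}, IsSemialgebraic ℚ W → ∀ {n : ℕ} (U : Fin n → Fin (m + 2)) {X : (Fin d → ℝ) → Fin n → ℝ} {P Q : (Fin d → ℝ) → ℝ}, (∀ i, IsSemialgebraicFunOn ℚ W fun z => X z i) → IsSemialgebraicFunOn ℚ W P → IsSemialgebraicFunOn ℚ W Q → IsSemialgebraicFunOn ℚ W fun z => dHt U (X z) (P z) (Q z)) ∧
    (∀ {d : ℕ} {W : Set (Fin d → ℝ)}, IsSemialgebraic ℚ W → ∀ {n : ℕ} (V : Fin n → Fin (m + 2)) {Y : (Fin d → ℝ) → Fin n → ℝ} {P Q : (Fin d → ℝ) → ℝ}, (∀ i, IsSemialgebraicFunOn ℚ W fun z => Y z i) → IsSemialgebraicFunOn ℚ W P → IsSemialgebraicFunOn ℚ W Q → IsSemialgebraicFunOn ℚ W fun z => dVt V (Y z) (P z) (Q z)) ∧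
    (∃ C : ℝ, ∀ (a : Fin (m + 2)) (ξ η : ℝ), 0 ≤ ξ → ξ ≤ (α : ℝ) → 0 ≤ η → η ≤ (β : ℝ) → (a ≠ ℓ → |fd a ξ η| ≤ C) ∧ (a ≠ ℓ' → |gd a ξ η| ≤ C) ∧ |dd a ξ η| ≤ C ∧ (∀ η' : ℝ, 0 ≤ η' → η' ≤ (β : ℝ) → |fd a ξ η - fd a ξ η'| ≤ C * |η - η'|) ∧ (∀ ξ' : ℝ, 0 ≤ ξ' → ξ' ≤ (α : ℝ) → |gd a ξ η - gd a ξ' η| ≤ C * |ξ - ξ'|)) ∧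
    (∀ k : ℕ, ∃ C : ℝ, ∀ (U : Fin k → Fin (m + 2)) (x : Fin k → ℝ) (ξ η : ℝ), (∀ i, 0 ≤ x i ∧ x i ≤ 1) → 0 ≤ ξ → ξ ≤ (α : ℝ) → 0 ≤ η → η ≤ (β : ℝ) → |Ht U x ξ η| ≤ C ∧ |dHt U x ξ η| ≤ C ∧ (0 < k → |Ht U x ξ η| ≤ C * ξ) ∧ (∀ η' : ℝ, 0 ≤ η' → η' ≤ (β : ℝ) → |Ht U x ξ η - Ht U x ξ η'| ≤ C * ξ * |η - η'|)) ∧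
    (∀ l : ℕ, ∃ C : ℝ, ∀ (V : Fin l → Fin (m + 2)) (y : Fin l → ℝ) (ξ η : ℝ), (∀ i, 0 ≤ y i ∧ y i ≤ 1) → 0 ≤ ξ → ξ ≤ (α : ℝ) → 0 ≤ η → η ≤ (β : ℝ) → |Vt V y ξ η| ≤ C ∧ |dVt V y ξ η| ≤ C ∧ (0 < l → |Vt V y ξ η| ≤ C * η) ∧ (∀ ξ' : ℝ, 0 ≤ ξ' → ξ' ≤ (α : ℝ) → |Vt V y ξ η - Vt V y ξ' η| ≤ C * η * |ξ - ξ'|)))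

/-! ### Step A.2 — auxiliary calculus and semialgebraicity for the transverse Newton–Leibniz step -/

include H in
/-- The transverse transport `η ↦ B^ν(x, y; ξ, η)` is differentiable on the closed rectangle
(base point `y` in the closed cube), with derivative `dB^ν(x, y; ξ, η)`: termwise, from the
derivative of the vertical word integrands in their second dilation.
[cite: KontsevichZagier2001, §1.2 rule (3)] -/
theorem CornerEngineNL.hasDerivAt_Bf (ν : (DrinfeldKohnoTrunc ℚ (Fin 4) N) →ₗ[ℚ] ℚ) {k l : ℕ}
    (x : Fin k → ℝ) (y : Fin l → ℝ) (hy : ∀ j, 0 ≤ y j ∧ y j ≤ 1) (ξ η : ℝ)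
    (hξ0 : 0 ≤ ξ) (hξ : ξ ≤ (α : ℝ)) (hη0 : 0 ≤ η) (hη : η ≤ (β : ℝ)) :
    HasDerivAt (fun s => Bf ν x y ξ s) (dBf ν x y ξ η) η := by
  obtain ⟨_, _, _, _, hBf, _, hdBf, _, _, _, _, _, _, _, _, _, _, _, _, _, _, _, _, _, _, _, _,
    _, _, _, _, _, hVt_deriv, _, _, _, _, _, _, _, _, _, _, _, _, _, _⟩ := H
  have h1 : (fun s => Bf ν x y ξ s) = fun s => ∑ U : Fin k → Fin (m + 2), ∑ V : Fin l → Fin (m + 2),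
      (ν (wZ V * wZ U) : ℝ) * (Vt V y ξ s * Ht U x ξ 0) := funext fun s => hBf ν x y ξ s
  rw [h1, hdBf]
  refine HasDerivAt.fun_sum fun U _ => HasDerivAt.fun_sum fun V _ => ?_
  exact ((hVt_deriv V y ξ η hy hξ0 hξ hη0 hη).mul_const _).const_mul _

include H in
/-- The transverse transport composed with `ℚ`-semialgebraic blocks and role functions is
`ℚ`-semialgebraic (a finite sum of products of rational constants and word integrands).
[cite: BochnakCosteRoy1998, Prop. 2.2.6] -/
theorem CornerEngineNL.sa_Bf (ν : (DrinfeldKohnoTrunc ℚ (Fin 4) N) →ₗ[ℚ] ℚ) {d : ℕ} {W : Set (Fin d → ℝ)}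
    (hW : IsSemialgebraic ℚ W) {k l : ℕ} {X : (Fin d → ℝ) → Fin k → ℝ} {Y : (Fin d → ℝ) → Fin l → ℝ}
    {P R : (Fin d → ℝ) → ℝ} (hX : ∀ i, IsSemialgebraicFunOn ℚ W fun z => X z i)
    (hY : ∀ j, IsSemialgebraicFunOn ℚ W fun z => Y z j) (hP : IsSemialgebraicFunOn ℚ W P)
    (hR : IsSemialgebraicFunOn ℚ W R) :
    IsSemialgebraicFunOn ℚ W fun z => Bf ν (X z) (Y z) (P z) (R z) := by
  obtain ⟨_, _, _, _, hBf, _, _, _, _, _, _, _, _, _, _, _, _, _, _, _, _, _, _, _, _, _, _, _,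
    _, _, _, _, _, _, _, _, _, _, _, _, hsa_Ht, hsa_Vt, _, _, _, _, _⟩ := H
  have h0 : IsSemialgebraicFunOn ℚ W fun _ => (0 : ℝ) :=
    (isSemialgebraicFunOn_const_ratCast hW 0).congr fun _ _ => Rat.cast_zero
  have h1 : (fun z => Bf ν (X z) (Y z) (P z) (R z)) = fun z => ∑ U : Fin k → Fin (m + 2),
      ∑ V : Fin l → Fin (m + 2), (ν (wZ V * wZ U) : ℝ) * (Vt V (Y z) (P z) (R z) * Ht U (X z) (P z) 0) :=
    funext fun z => hBf ν _ _ _ _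
  rw [h1]
  refine IsSemialgebraicFunOn.fun_finsetSum _ hW fun U _ =>
    IsSemialgebraicFunOn.fun_finsetSum _ hW fun V _ => ?_
  exact (isSemialgebraicFunOn_const_ratCast hW _).fun_mul
    ((hsa_Vt hW V hY hP hR).fun_mul (hsa_Ht hW U hX hP h0))

include H in
/-- **The fibres of the primitive of Step A.2.** Along the new last parameter `s`, the primitive
`s ↦ σ₀ Ξ₀ · fd_a(Ξ₀ s₀, Η₀ s) · B^ν(x, y; Ξ₀ s₀, Η₀ s)` is differentiable at every `s ∈ [0,1]`,
with derivative the band integrand `σ₀ Ξ₀ Η₀ (dd_a B^ν + fd_a dB^ν)` at `(Ξ₀ s₀, Η₀ s)` (chain and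
product rules; `(Ξ₀, Η₀)` in the rectangle, `s₀ ∈ [0,1]`, `y` in the closed cube).
[cite: KontsevichZagier2001, §1.2 rule (3)] -/
theorem CornerEngineNL.hasDerivAt_fiber (ν : (DrinfeldKohnoTrunc ℚ (Fin 4) N) →ₗ[ℚ] ℚ) {k l : ℕ}
    (x : Fin k → ℝ) (y : Fin l → ℝ) (hy : ∀ j, 0 ≤ y j ∧ y j ≤ 1) (a : Fin (m + 2))
    (σ₀ A B s₀ : ℝ) (hA0 : 0 ≤ A) (hA : A ≤ (α : ℝ)) (hB0 : 0 ≤ B) (hB : B ≤ (β : ℝ))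
    (hs0 : 0 ≤ s₀) (hs1 : s₀ ≤ 1) (t : ℝ) (ht : t ∈ Icc (0 : ℝ) 1) :
    HasDerivAt (fun s => σ₀ * A * fd a (A * s₀) (B * s) * Bf ν x y (A * s₀) (B * s))
      (σ₀ * A * B * (dd a (A * s₀) (B * t) * Bf ν x y (A * s₀) (B * t)) +
        σ₀ * A * B * (fd a (A * s₀) (B * t) * dBf ν x y (A * s₀) (B * t))) t := by
  have hDBf := CornerEngineNL.hasDerivAt_Bf H ν x y hy
  obtain ⟨_, _, _, _, _, _, _, _, _, _, _, _, _, _, _, _, _, _, _, _, _, _, _, _, _, _, _, _, _,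
    hfd_deriv, _, _, _, _, _, _, _, _, _, _, _, _, _, _, _, _, _⟩ := H
  have hBt0 : 0 ≤ B * t := mul_nonneg hB0 ht.1
  have hBtβ : B * t ≤ (β : ℝ) := (mul_le_of_le_one_right hB0 ht.2).trans hB
  have hξ0 : 0 ≤ A * s₀ := mul_nonneg hA0 hs0
  have hξα : A * s₀ ≤ (α : ℝ) := (mul_le_of_le_one_right hA0 hs1).trans hA
  have hc : HasDerivAt (fun s : ℝ => B * s) B t := by
    simpa using (hasDerivAt_id t).const_mul B
  have h1 : HasDerivAt (fun s => fd a (A * s₀) (B * s)) (dd a (A * s₀) (B * t) * B) t :=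
    (hfd_deriv a (A * s₀) (B * t) hξ0 hξα hBt0 hBtβ).comp t hc
  have h2 : HasDerivAt (fun s => Bf ν x y (A * s₀) (B * s)) (dBf ν x y (A * s₀) (B * t) * B) t :=
    (hDBf (A * s₀) (B * t) hξ0 hξα hBt0 hBtβ).comp t hc
  have h3 := (h1.mul h2).const_mul (σ₀ * A)
  refine (h3.congr_of_eventuallyEq (Filter.Eventually.of_forall fun s => ?_)).congr_deriv ?_
  · simp only [Pi.mul_apply]; ring
  · ring

/-! ### Step A.2 — Newton–Leibniz across the transverse direction (letters `a ≠ ℓ`)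

`σ Ξ [fd_a(Ξ₁,Η) B(Ξ₁,Η) − fd_a(Ξ₁,0) B(Ξ₁,0)] = ∫₀¹ ∂_{s'} [σ Ξ fd_a(Ξ₁, Η s') B(Ξ₁, Η s')] ds'`:
rule (3) along a new last parameter `s'` (`Η₁ = Η s'`), the band integrand splitting into the
`dd_a`-term `W₁` and the `dB`-term `W₂`. -/

include H in
/-- **Step A.2 (transverse Newton–Leibniz).** [cite: KontsevichZagier2001, §1.2 rule (3)] -/
theorem stepA_nl (μ : (DrinfeldKohnoTrunc ℚ (Fin 4) N) →ₗ[ℚ] ℚ) (k l e : ℕ) (Ξ Η σ : (Fin e → ℝ) → ℝ)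
    (hΞΗ : ∀ θ ∈ KZ.cube e, 0 ≤ Ξ θ ∧ Ξ θ ≤ (α : ℝ) ∧ 0 ≤ Η θ ∧ Η θ ≤ (β : ℝ))
    (hsaΞ : IsSemialgebraicFunOn ℚ (KZ.cube e) Ξ) (hsaΗ : IsSemialgebraicFunOn ℚ (KZ.cube e) Η)
    (hsaσ : IsSemialgebraicFunOn ℚ (KZ.cube e) σ)
    (a : Fin (m + 2))
    (Ξ₁ Η₁ ρ : (Fin (e + 1) → ℝ) → ℝ)
    (hΞ₁ : ∀ θ', Ξ₁ θ' = Ξ (Fin.init θ') * θ' (Fin.last e)) (hΗ₁ : ∀ θ', Η₁ θ' = Η (Fin.init θ'))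
    (hρ : ∀ θ', ρ θ' = σ (Fin.init θ') * Ξ (Fin.init θ'))
    (Ξ₂ Η₂ ρ₂ : (Fin (e + 2) → ℝ) → ℝ)
    (hΞ₂ : ∀ θ'', Ξ₂ θ'' = Ξ (Fin.init (Fin.init θ'')) * θ'' (Fin.castSucc (Fin.last e)))
    (hΗ₂ : ∀ θ'', Η₂ θ'' = Η (Fin.init (Fin.init θ'')) * θ'' (Fin.last (e + 1)))
    (hρ₂ : ∀ θ'', ρ₂ θ'' = σ (Fin.init (Fin.init θ'')) * Ξ (Fin.init (Fin.init θ'')) * Η (Fin.init (Fin.init θ'')))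
    (Q : KZ.IntegralRep (k + l + (e + 1))) (hQd : Q.domain = KZ.cube (k + l + (e + 1)))
    (hQi : Q.integrand = fun w => ρ (Θb k l (e + 1) w) *
      (fd a (Ξ₁ (Θb k l (e + 1) w)) (Η₁ (Θb k l (e + 1) w)) *
          Bf (μ ∘ₗ op a) (Xb k l (e + 1) w) (Yb k l (e + 1) w) (Ξ₁ (Θb k l (e + 1) w)) (Η₁ (Θb k l (e + 1) w)) -
        fd a (Ξ₁ (Θb k l (e + 1) w)) 0 *
          Bf (μ ∘ₗ op a) (Xb k l (e + 1) w) (Yb k l (e + 1) w) (Ξ₁ (Θb k l (e + 1) w)) 0))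
    (W₁ W₂ : KZ.IntegralRep (k + l + (e + 2)))
    (hW₁d : W₁.domain = KZ.cube (k + l + (e + 2))) (hW₂d : W₂.domain = KZ.cube (k + l + (e + 2)))
    (hW₁i : W₁.integrand = fun w => ρ₂ (Θb k l (e + 2) w) *
      (dd a (Ξ₂ (Θb k l (e + 2) w)) (Η₂ (Θb k l (e + 2) w)) *
        Bf (μ ∘ₗ op a) (Xb k l (e + 2) w) (Yb k l (e + 2) w) (Ξ₂ (Θb k l (e + 2) w)) (Η₂ (Θb k l (e + 2) w))))
    (hW₂i : W₂.integrand = fun w => ρ₂ (Θb k l (e + 2) w) *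
      (fd a (Ξ₂ (Θb k l (e + 2) w)) (Η₂ (Θb k l (e + 2) w)) *
        dBf (μ ∘ₗ op a) (Xb k l (e + 2) w) (Yb k l (e + 2) w) (Ξ₂ (Θb k l (e + 2) w)) (Η₂ (Θb k l (e + 2) w)))) :
    KZ.toPeriodAlgebra (KZ.toFormalPeriod (KZ.of Q)) =
      KZ.toPeriodAlgebra (KZ.toFormalPeriod (KZ.of W₁)) + KZ.toPeriodAlgebra (KZ.toFormalPeriod (KZ.of W₂)) := by
  obtain ⟨_, _, _, _, _, _, _, _, hXb, hYb, hΘb, _, _, _, _, _, _, _, _, _, _, _, _, _, _, _, _,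
    _, _, _, _, _, _, _, _, _, _, hsa_fd, _, _, _, _, _, _, _, _, _⟩ := id H
  have hcube : IsSemialgebraic ℚ (KZ.cube (k + l + (e + 1) + 1)) := KZ.isSemialgebraic_cube
  /- the band representation `S = W₁ + W₂` on the cube `[0,1]^{(k+l+(e+1))+1} = [0,1]^{k+l+(e+2)}` -/
  have hW₁s : IsSemialgebraicFunOn ℚ (KZ.cube (k + l + (e + 2))) W₁.integrand :=
    hW₁d ▸ W₁.isSemialgebraicFunOn_integrand
  have hW₂s : IsSemialgebraicFunOn ℚ (KZ.cube (k + l + (e + 2))) W₂.integrand :=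
    hW₂d ▸ W₂.isSemialgebraicFunOn_integrand
  have hW₁n : IntegrableOn W₁.integrand (KZ.cube (k + l + (e + 2))) := hW₁d ▸ W₁.integrableOn
  have hW₂n : IntegrableOn W₂.integrand (KZ.cube (k + l + (e + 2))) := hW₂d ▸ W₂.integrableOn
  let S : KZ.IntegralRep (k + l + (e + 1) + 1) :=
    ⟨KZ.cube _, fun w => W₁.integrand w + W₂.integrand w, KZ.isSemialgebraic_cube,
      hW₁s.fun_add hW₂s, hW₁n.add hW₂n⟩
  have hS : KZ.toPeriodAlgebra (KZ.toFormalPeriod (KZ.of S)) =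
      KZ.toPeriodAlgebra (KZ.toFormalPeriod (KZ.of W₁)) + KZ.toPeriodAlgebra (KZ.toFormalPeriod (KZ.of W₂)) :=
    CornerReps.cls_add (r := S) (r₁ := W₁) (r₂ := W₂) hW₁d hW₂d fun _ _ => rfl
  /- the primitive `G = ρ(θ') · fd_a(Ξ₂, Η₂) · B^ν(x', y; Ξ₂, Η₂)` on `[0,1]^{k+l+(e+2)}` -/
  let G : (Fin (k + l + (e + 1) + 1) → ℝ) → ℝ := fun z =>
    ρ (Fin.init (Θb k l (e + 2) z)) * fd a (Ξ₂ (Θb k l (e + 2) z)) (Η₂ (Θb k l (e + 2) z)) *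
      Bf (μ ∘ₗ op a) (Xb k l (e + 2) z) (Yb k l (e + 2) z) (Ξ₂ (Θb k l (e + 2) z)) (Η₂ (Θb k l (e + 2) z))
  /- blocks of `Fin.snoc x t` -/
  have hblk : ∀ (x : Fin (k + l + (e + 1)) → ℝ) (t : ℝ),
      Xb k l (e + 2) (Fin.snoc x t : Fin (k + l + (e + 1) + 1) → ℝ) = Xb k l (e + 1) x ∧
        Yb k l (e + 2) (Fin.snoc x t : Fin (k + l + (e + 1) + 1) → ℝ) = Yb k l (e + 1) x ∧
        Θb k l (e + 2) (Fin.snoc x t : Fin (k + l + (e + 1) + 1) → ℝ) = Fin.snoc (Θb k l (e + 1) x) t := by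
    intro x t
    obtain ⟨h1, h2, h3⟩ := CornerEngineNL.snoc_blocks k l e x t
    refine ⟨?_, ?_, ?_⟩
    · rw [hXb, hXb]; exact h1
    · rw [hYb, hYb]; exact h2
    · rw [hΘb, hΘb]; exact h3
  /- the primitive on the fibres `s ↦ Fin.snoc x s` -/
  have hGsnoc : ∀ (x : Fin (k + l + (e + 1)) → ℝ) (s : ℝ), G (Fin.snoc x s) =
      σ (Fin.init (Θb k l (e + 1) x)) * Ξ (Fin.init (Θb k l (e + 1) x)) *
        fd a (Ξ (Fin.init (Θb k l (e + 1) x)) * Θb k l (e + 1) x (Fin.last e))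
          (Η (Fin.init (Θb k l (e + 1) x)) * s) *
        Bf (μ ∘ₗ op a) (Xb k l (e + 1) x) (Yb k l (e + 1) x)
          (Ξ (Fin.init (Θb k l (e + 1) x)) * Θb k l (e + 1) x (Fin.last e))
          (Η (Fin.init (Θb k l (e + 1) x)) * s) := by
    intro x s
    obtain ⟨h1, h2, h3⟩ := hblk x s
    simp only [G, h1, h2, h3, hρ, hΞ₂, hΗ₂, Fin.init_snoc, Fin.snoc_last, Fin.snoc_castSucc]
  /- differentiability along the fibres over the open base cube, derivative the band integrand -/
  have hHD : ∀ x ∈ openUnitCube (k + l + (e + 1)), ∀ t ∈ Icc (0 : ℝ) 1,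
      HasDerivAt (fun s : ℝ => G (Fin.snoc x s))
        (W₁.integrand (Fin.snoc x t : Fin (k + l + (e + 1) + 1) → ℝ) +
          W₂.integrand (Fin.snoc x t : Fin (k + l + (e + 1) + 1) → ℝ)) t := by
    intro x hx t ht
    have hy01 : ∀ j, 0 ≤ Yb k l (e + 1) x j ∧ Yb k l (e + 1) x j ≤ 1 := fun j => by
      rw [hYb]
      exact ⟨(hx (Fin.castAdd (e + 1) (Fin.natAdd k j))).1.le, (hx (Fin.castAdd (e + 1) (Fin.natAdd k j))).2.le⟩
    have hΘ01 : ∀ s, 0 ≤ Θb k l (e + 1) x s ∧ Θb k l (e + 1) x s ≤ 1 := fun s => by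
      rw [hΘb]
      exact ⟨(hx (Fin.natAdd (k + l) s)).1.le, (hx (Fin.natAdd (k + l) s)).2.le⟩
    obtain ⟨hA0, hAα, hB0, hBβ⟩ :=
      hΞΗ (Fin.init (Θb k l (e + 1) x)) (KZ.mem_cube.2 fun i => hΘ01 (Fin.castSucc i))
    have key := CornerEngineNL.hasDerivAt_fiber H (μ ∘ₗ op a) (Xb k l (e + 1) x) (Yb k l (e + 1) x) hy01 a
      (σ (Fin.init (Θb k l (e + 1) x))) (Ξ (Fin.init (Θb k l (e + 1) x)))
      (Η (Fin.init (Θb k l (e + 1) x))) (Θb k l (e + 1) x (Fin.last e)) hA0 hAα hB0 hBβ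
      (hΘ01 _).1 (hΘ01 _).2 t ht
    obtain ⟨h1, h2, h3⟩ := hblk x t
    convert key using 1
    · exact funext fun s => hGsnoc x s
    · simp only [hW₁i, hW₂i, h1, h2, h3, hρ₂, hΞ₂, hΗ₂, Fin.init_snoc, Fin.snoc_last, Fin.snoc_castSucc]
  /- evaluation of the primitive at `s = 1`, `s = 0` -/
  have hbase : ∀ x ∈ openUnitCube (k + l + (e + 1)),
      Q.integrand x = G (Fin.snoc x 1) - G (Fin.snoc x 0) := by
    intro x _
    rw [hGsnoc, hGsnoc, hQi]
    simp only [hρ, hΞ₁, hΗ₁, mul_one, mul_zero]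
    ring
  /- semialgebraicity of the primitive on the closed cube -/
  have hSD : ∀ z ∈ KZ.cube (k + l + (e + 1) + 1),
      (fun s : Fin e => z (Fin.natAdd (m := e + 2) (k + l) (Fin.castSucc (Fin.castSucc s)))) ∈ KZ.cube e :=
    fun z hz => KZ.mem_cube.2 fun s => KZ.mem_cube.1 hz _
  have hθ₀ : ∀ z : Fin (k + l + (e + 1) + 1) → ℝ,
      (fun s : Fin e => z (Fin.natAdd (m := e + 2) (k + l) (Fin.castSucc (Fin.castSucc s)))) =
        Fin.init (Fin.init (Θb k l (e + 2) z)) := fun z => by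
    rw [hΘb]; rfl
  have saΞ₀ : IsSemialgebraicFunOn ℚ (KZ.cube (k + l + (e + 1) + 1)) fun z =>
      Ξ (Fin.init (Fin.init (Θb k l (e + 2) z))) :=
    (qe_comp_proj _ hsaΞ hcube hSD).congr fun z _ => by rw [← hθ₀]
  have saΗ₀ : IsSemialgebraicFunOn ℚ (KZ.cube (k + l + (e + 1) + 1)) fun z =>
      Η (Fin.init (Fin.init (Θb k l (e + 2) z))) :=
    (qe_comp_proj _ hsaΗ hcube hSD).congr fun z _ => by rw [← hθ₀]
  have saσ₀ : IsSemialgebraicFunOn ℚ (KZ.cube (k + l + (e + 1) + 1)) fun z =>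
      σ (Fin.init (Fin.init (Θb k l (e + 2) z))) :=
    (qe_comp_proj _ hsaσ hcube hSD).congr fun z _ => by rw [← hθ₀]
  have saS : IsSemialgebraicFunOn ℚ (KZ.cube (k + l + (e + 1) + 1)) fun z =>
      Θb k l (e + 2) z (Fin.castSucc (Fin.last e)) :=
    (CornerEngineNL.sa_coord hcube (Fin.natAdd (m := e + 2) (k + l) (Fin.castSucc (Fin.last e)))).congr
      fun z _ => by rw [hΘb]
  have saT : IsSemialgebraicFunOn ℚ (KZ.cube (k + l + (e + 1) + 1)) fun z =>
      Θb k l (e + 2) z (Fin.last (e + 1)) :=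
    (CornerEngineNL.sa_coord hcube (Fin.natAdd (m := e + 2) (k + l) (Fin.last (e + 1)))).congr
      fun z _ => by rw [hΘb]
  have saΞ₂ : IsSemialgebraicFunOn ℚ (KZ.cube (k + l + (e + 1) + 1)) fun z => Ξ₂ (Θb k l (e + 2) z) :=
    (saΞ₀.fun_mul saS).congr fun z _ => by rw [hΞ₂]
  have saΗ₂ : IsSemialgebraicFunOn ℚ (KZ.cube (k + l + (e + 1) + 1)) fun z => Η₂ (Θb k l (e + 2) z) :=
    (saΗ₀.fun_mul saT).congr fun z _ => by rw [hΗ₂]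
  have saρ : IsSemialgebraicFunOn ℚ (KZ.cube (k + l + (e + 1) + 1)) fun z =>
      ρ (Fin.init (Θb k l (e + 2) z)) :=
    (saσ₀.fun_mul saΞ₀).congr fun z _ => by rw [hρ]
  have saX : ∀ i, IsSemialgebraicFunOn ℚ (KZ.cube (k + l + (e + 1) + 1)) fun z => Xb k l (e + 2) z i :=
    fun i => (CornerEngineNL.sa_coord hcube
      (Fin.castAdd (e + 2) (Fin.castAdd l i) : Fin (k + l + (e + 2)))).congr fun z _ => by rw [hXb]
  have saY : ∀ j, IsSemialgebraicFunOn ℚ (KZ.cube (k + l + (e + 1) + 1)) fun z => Yb k l (e + 2) z j :=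
    fun j => (CornerEngineNL.sa_coord hcube
      (Fin.castAdd (e + 2) (Fin.natAdd k j) : Fin (k + l + (e + 2)))).congr fun z _ => by rw [hYb]
  have hG : IsSemialgebraicFunOn ℚ (KZ.cube (k + l + (e + 1) + 1)) G :=
    (saρ.fun_mul (hsa_fd hcube a saΞ₂ saΗ₂)).fun_mul
      (CornerEngineNL.sa_Bf H (μ ∘ₗ op a) hcube saX saY saΞ₂ saΗ₂)
  /- rule (3) along the last coordinate, then integrand additivity -/
  exact (CornerCubes.cls_newtonLeibniz_open S Q G rfl hQd hG
    (fun x hx t ht => (hHD x hx t ht).continuousAt.continuousWithinAt)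
    (fun x hx t ht => hHD x hx t (Ioo_subset_Icc_self ht)) hbase).symm.trans hS

end AbstractEngine

/-- **Hook `cornerEngineNL_snoc_blocks`** (registered form of `CornerEngineNL.snoc_blocks`): the
three coordinate blocks of `Fin.snoc w t ∈ ℝ^{k+l+(e+2)}` for `w ∈ ℝ^{k+l+(e+1)}` with blocks
`x' | y | θ'` are `x' | y | Fin.snoc θ' t`. [folklore] -/
theorem cornerEngineNL_snoc_blocks : ∀ (k l e : ℕ) (w : Fin (k + l + (e + 1)) → ℝ) (t : ℝ), (fun i : Fin k => (Fin.snoc w t : Fin (k + l + (e + 1) + 1) → ℝ) (Fin.castAdd (e + 2) (Fin.castAdd l i) : Fin (k + l + (e + 2)))) = (fun i : Fin k => w (Fin.castAdd (e + 1) (Fin.castAdd l i))) ∧ (fun j : Fin l => (Fin.snoc w t : Fin (k + l + (e + 1) + 1) → ℝ) (Fin.castAdd (e + 2) (Fin.natAdd k j) : Fin (k + l + (e + 2)))) = (fun j : Fin l => w (Fin.castAdd (e + 1) (Fin.natAdd k j))) ∧ (fun s : Fin (e + 2) => (Fin.snoc w t : Fin (k + l + (e + 1) + 1) → ℝ) (Fin.natAdd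 (k + l) s : Fin (k + l + (e + 2)))) = Fin.snoc (fun s : Fin (e + 1) => w (Fin.natAdd (k + l) s)) t :=
  CornerEngineNL.snoc_blocks

end Summit.KontsevichZagierPeriods.FurushoPentagon.PentagonInKZ
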